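import Literature.Probability.RandomPlanarGeometry.HexSAWSurfaceWallRenewalSlackTwoClassification
import Literature.Probability.RandomPlanarGeometry.HexSAWSurfaceWallRenewalIteratedGap
import HarnessLib

/-!
# Slack four, four down steps: the order `D D U D U D U U` (one excursion with three dips) does not occur

For the self-avoiding walk on the honeycomb lattice (brick-wall frame) in the half-plane `Y ≤ 0`, consider an IRREDUCIBLE
POSITIVE WALL BRIDGE `ω ∈ ipwb m` at SLACK FOUR (`m = 6k + 4`, `k = visits m ω ≥ 2`) with FOUR down steps, in the vertical
profile of `profile_of_card_stepsD_eq_four` (`…FourDownProfile`): down times `p₁ < p₂ < p₃ < p₄`, up times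
`r₁ < r₂ < r₃ < r₄`, the initial wall run `(i, 0)`, `i ≤ p₁`, the first dive at the odd time `p₁`, all other steps horizontal.

* `ddududuu_slack_four_false` — the vertical order `p₁ < p₂ < r₁ < p₃ < r₂ < p₄ < r₃ < r₄` (word `D D U D U D U U`: a
  single excursion below the wall which dips three times from the row `−1` to the row `−2`) is impossible.

PROOF (pigeonhole in the two rows below the wall).  §1 `ddududuu4_runs` is the run decomposition of the order (seven
monotone body runs on the rows `−1, −2, −1, −2, −1, −2, −1`, `run_const_velocity` of `…SecondGap`; the rightward final
wall run; the visit count `r₄ + 2k + 1 = m + p₁`, i.e. the body `(p₁, r₄]` has exactly `4k + 3` sites, all on the rows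
`−1, −2`).  §2: the interior visit times are those of the initial run and of the final run only; a final-run visit time
that is a near-renewal (`NearRenewal` of `…SixStep`) would be a wall-renewal time (`isWRen_of_profile`), an initial-run
visit time `t ≥ 4` is not a near-renewal (`exists_left_step_onto` at the time `2`), so `#E ≤ 1`
(`ddududuu_card_nearRenewal_le`); `slack_four_counts` (`…IteratedGap`) then gives the span `X = 2k + 2` AND `#E = 1` with
no near-renewal `≥ 4`, so the time `2` is a near-renewal: every later column is `≥ 2`.  Hence the `4k + 3` distinct body
sites lie in the box `[2, 2k + 2] × {−2, −1}` of `4k + 2` sites (`Finset.card_le_card_of_injOn`) — contradiction.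

STATUS: lane theorem of the a-idea-1 bridge/renewal lineage (car 94-F), sixth module of the ORDER EXCLUSION for four down
steps at slack four (FINDING-HEX-WALL-SLACK-FOUR-LAW, the four-down law `12·N = (k − 2)(2k⁴ − 7k³ + 4k² + 7k + 6)`).  OURS
(routine): checked against the lane's enumeration of all irreducible positive wall bridges at slack four for `k ≤ 8` (no
word `D D U D U D U U` among the `0, 3, 27, 129, 424, 1105, 2463` four-down walks at `k = 2 … 8`).  The printed sources carry
the renewal / irreducible-bridge structure (Madras–Slade §4.2, Definition 4.2.1, remark before (4.2.21), p. 94) and the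
brickwork frame of the honeycomb lattice (Enting–Jensen §7.4.2, Fig. 7.10) — none states this fact.
No `set_option maxHeartbeats` line is used.
-/

namespace Literature.Probability.RandomPlanarGeometry.SAW.HexBW.Wall

open Finset Filter Function
open Literature.Probability.LatticeModels Literature.Probability.Percolation SimpleGraph

variable {ω : ℕ → Site 2}

/-- [folklore] Two coordinates determine a site of `ℤ²`. -/
private theorem site_ext_td {p q : Site 2} (h0 : p 0 = q 0) (h1 : p 1 = q 1) : p = q := by
  funext k
  fin_cases k
  · exact h0
  · exact h1

/-- [folklore] Slack-four visit numerics, no interior wall run. -/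
private theorem visits_count_td_w0 {k m p r : ℕ} (hm : m = 6 * k + 4) (hv : p / 2 + (m - r) / 2 = k) (hp : p % 2 = 1)
    (hr : r % 2 = 0) (hrm : r < m) : r + 2 * k + 1 = m + p := by
  omega

/-- **Runs of the order `D D U D U D U U`.** For `m = 6k + 4`, `ω ∈ ipwb m` with `k` visits, four down steps at
`p₁ < p₂ < p₃ < p₄` and four up steps at `r₁ < r₂ < r₃ < r₄` in the order `p₂ < r₁ < p₃ < r₂ < p₄ < r₃`, in the profile of
`profile_of_card_stepsD_eq_four`: the seven monotone body runs (rows `−1, −2, −1, −2, −1, −2, −1`) with their signs, the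
rightward final wall run, the visit count `r₄ + 2k + 1 = m + p₁` (wall visits on the initial and on the final run only),
the final-run length, the column parities, the positivity of the interior columns and the gaps.  Same generator as the
occurring orders (`…SlackFourFourDownRuns`); tool for `ddududuu_slack_four_false`.  OURS (routine).
[cite: MadrasSlade1993, §4.2, Definition 4.2.1 (p. 90), (4.2.2); EntingJensen2009, §7.4.2, Fig. 7.10] -/
theorem ddududuu4_runs {k m : ℕ} (hm : m = 6 * k + 4) (hω : ω ∈ ipwb m) (hv : visits m ω = k)
    {p₁ p₂ p₃ p₄ r₁ r₂ r₃ r₄ : ℕ} (hD : stepsD m ω = {p₁, p₂, p₃, p₄}) (hU : stepsU m ω = {r₁, r₂, r₃, r₄})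
    (h12 : p₁ < p₂) (h23 : p₂ < p₃) (h34 : p₃ < p₄) (hr12 : r₁ < r₂) (hr23 : r₂ < r₃) (hr34 : r₃ < r₄)
    (ht2 : p₂ < r₁) (ht3 : r₁ < p₃) (ht4 : p₃ < r₂) (ht5 : r₂ < p₄) (ht6 : p₄ < r₃) (hp1 : 1 ≤ p₁)
    (hR0 : ∀ i, i ≤ p₁ → ω i 0 = i ∧ ω i 1 = 0)
    (hP1x : ω (p₁ + 1) 0 = p₁) (hP1y : ω (p₁ + 1) 1 = -1)
    (hhor : ∀ i, i < m → i ∉ stepsD m ω → i ∉ stepsU m ω →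
      ω (i + 1) 1 = ω i 1 ∧ (ω (i + 1) 0 = ω i 0 + 1 ∨ ω (i + 1) 0 = ω i 0 - 1)) :
    ∃ e₁ e₂ e₃ e₄ e₅ e₆ e₇ : ℤ, (e₁ = 1 ∨ e₁ = -1) ∧ (e₂ = 1 ∨ e₂ = -1) ∧ (e₃ = 1 ∨ e₃ = -1) ∧ (e₄ = 1 ∨ e₄ = -1) ∧
      (e₅ = 1 ∨ e₅ = -1) ∧ (e₆ = 1 ∨ e₆ = -1) ∧ (e₇ = 1 ∨ e₇ = -1) ∧
      (∀ i, p₁ + 1 ≤ i → i ≤ p₂ → ω i 0 = p₁ + e₁ * ((i - (p₁ + 1) : ℕ) : ℤ) ∧ ω i 1 = -1) ∧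
      (∀ i, p₂ + 1 ≤ i → i ≤ r₁ → ω i 0 = ω p₂ 0 + e₂ * ((i - (p₂ + 1) : ℕ) : ℤ) ∧ ω i 1 = -2) ∧
      (∀ i, r₁ + 1 ≤ i → i ≤ p₃ → ω i 0 = ω r₁ 0 + e₃ * ((i - (r₁ + 1) : ℕ) : ℤ) ∧ ω i 1 = -1) ∧
      (∀ i, p₃ + 1 ≤ i → i ≤ r₂ → ω i 0 = ω p₃ 0 + e₄ * ((i - (p₃ + 1) : ℕ) : ℤ) ∧ ω i 1 = -2) ∧
      (∀ i, r₂ + 1 ≤ i → i ≤ p₄ → ω i 0 = ω r₂ 0 + e₅ * ((i - (r₂ + 1) : ℕ) : ℤ) ∧ ω i 1 = -1) ∧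
      (∀ i, p₄ + 1 ≤ i → i ≤ r₃ → ω i 0 = ω p₄ 0 + e₆ * ((i - (p₄ + 1) : ℕ) : ℤ) ∧ ω i 1 = -2) ∧
      (∀ i, r₃ + 1 ≤ i → i ≤ r₄ → ω i 0 = ω r₃ 0 + e₇ * ((i - (r₃ + 1) : ℕ) : ℤ) ∧ ω i 1 = -1) ∧
      (∀ j, r₄ + 1 ≤ j → j ≤ m → ω j 0 = ω r₄ 0 + ((j - (r₄ + 1) : ℕ) : ℤ) ∧ ω j 1 = 0) ∧
      r₄ + 2 * k + 1 = m + p₁ ∧ ω m 0 + p₁ = ω r₄ 0 + 2 * k ∧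
      ω p₂ 0 % 2 = 0 ∧ ω r₁ 0 % 2 = 0 ∧ ω p₃ 0 % 2 = 0 ∧ ω r₂ 0 % 2 = 0 ∧ ω p₄ 0 % 2 = 0 ∧ ω r₃ 0 % 2 = 0 ∧
      ω r₄ 0 % 2 = 1 ∧ 0 < ω p₂ 0 ∧ 0 < ω r₁ 0 ∧ 0 < ω p₃ 0 ∧ 0 < ω r₂ 0 ∧ 0 < ω p₄ 0 ∧ 0 < ω r₃ 0 ∧ p₁ + 2 ≤ p₂ ∧
      p₂ + 2 ≤ r₁ ∧ r₁ + 2 ≤ p₃ ∧ p₃ + 2 ≤ r₂ ∧ r₂ + 2 ≤ p₄ ∧ p₄ + 2 ≤ r₃ ∧ r₄ < m := by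
  classical
  obtain ⟨hpw, hn1, hirr⟩ := mem_ipwb.1 hω
  obtain ⟨hw, hb⟩ := mem_pwb.1 hpw
  obtain ⟨ha, -⟩ := mem_wbr.1 hw
  obtain ⟨hh, -, -⟩ := mem_archs.1 ha
  obtain ⟨hs, hhp⟩ := mem_hpw.1 hh
  obtain ⟨h0, -, hbw, hinj⟩ := mem_saws_iff.1 hs
  have hX0 : ω 0 0 = 0 := by rw [h0]; rfl
  have hb' : ∀ i, 1 ≤ i → i ≤ m → 0 < ω i 0 ∧ ω i 0 ≤ ω m 0 := fun i h1 h2 => by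
    have := hb i h1 h2; rwa [hX0] at this
  have hmem : ∀ i, i ≤ m → i ∈ {i | i ≤ m} := fun i hi => hi
  have hmD : ∀ i, i ∈ stepsD m ω ↔ i = p₁ ∨ i = p₂ ∨ i = p₃ ∨ i = p₄ := fun i => by
    rw [hD]; simp only [Finset.mem_insert, Finset.mem_singleton]
  have hmU : ∀ i, i ∈ stepsU m ω ↔ i = r₁ ∨ i = r₂ ∨ i = r₃ ∨ i = r₄ := fun i => by
    rw [hU]; simp only [Finset.mem_insert, Finset.mem_singleton]
  obtain ⟨-, -, -, hpar_p₁⟩ := of_mem_stepsD_coord hbw (i := p₁) ((hmD _).2 (by simp))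
  have hx_p₁ : ω (p₁ + 1) 0 = ω p₁ 0 := by rw [hP1x, (hR0 p₁ le_rfl).1]
  have hy_p₁ : ω p₁ 1 = 0 := (hR0 p₁ le_rfl).2
  obtain ⟨hn_p₂, hx_p₂, hys_p₂, hpar_p₂⟩ := of_mem_stepsD_coord hbw (i := p₂) ((hmD _).2 (by simp))
  obtain ⟨hn_r₁, hx_r₁, hys_r₁, hpar_r₁⟩ := of_mem_stepsU_coord hbw (i := r₁) ((hmU _).2 (by simp))
  obtain ⟨hn_p₃, hx_p₃, hys_p₃, hpar_p₃⟩ := of_mem_stepsD_coord hbw (i := p₃) ((hmD _).2 (by simp))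
  obtain ⟨hn_r₂, hx_r₂, hys_r₂, hpar_r₂⟩ := of_mem_stepsU_coord hbw (i := r₂) ((hmU _).2 (by simp))
  obtain ⟨hn_p₄, hx_p₄, hys_p₄, hpar_p₄⟩ := of_mem_stepsD_coord hbw (i := p₄) ((hmD _).2 (by simp))
  obtain ⟨hn_r₃, hx_r₃, hys_r₃, hpar_r₃⟩ := of_mem_stepsU_coord hbw (i := r₃) ((hmU _).2 (by simp))
  obtain ⟨hn_r₄, hx_r₄, hys_r₄, hpar_r₄⟩ := of_mem_stepsU_coord hbw (i := r₄) ((hmU _).2 (by simp))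
  have hhor' : ∀ i, i < m → i ≠ p₁ → i ≠ p₂ → i ≠ p₃ → i ≠ p₄ → i ≠ r₁ → i ≠ r₂ → i ≠ r₃ → i ≠ r₄ →
      ω (i + 1) 1 = ω i 1 ∧ (ω (i + 1) 0 = ω i 0 + 1 ∨ ω (i + 1) 0 = ω i 0 - 1) :=
    fun i hi n1 n2 n3 n4 n5 n6 n7 n8 => hhor i hi (by rw [hmD]; omega) (by rw [hmU]; omega)
  -- run 1 on row `−1`
  obtain ⟨e1, he1, hrun1⟩ := run_const_velocity hinj (a := p₁ + 1) (b := p₂) (by omega) (by omega)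
    (fun i hi1 hi2 => hhor' i (by omega) (by omega) (by omega) (by omega) (by omega) (by omega) (by omega) (by omega) (by omega))
  have hy_p₂ : ω p₂ 1 = -1 := by rw [(hrun1 p₂ (by omega) le_rfl).2, hP1y]
  have hy1_p₂ : ω (p₂ + 1) 1 = -2 := by rw [hys_p₂, hy_p₂]; rfl
  have hparc_p₂ : ω p₂ 0 % 2 = 0 := by rw [hx_p₂, hy1_p₂] at hpar_p₂; omega
  have hpos_p₂ := (hb' p₂ (by omega) (by omega)).1
  -- run 2 on row `−2`
  obtain ⟨e2, he2, hrun2⟩ := run_const_velocity hinj (a := p₂ + 1) (b := r₁) (by omega) (by omega)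
    (fun i hi1 hi2 => hhor' i (by omega) (by omega) (by omega) (by omega) (by omega) (by omega) (by omega) (by omega) (by omega))
  have hy_r₁ : ω r₁ 1 = -2 := by rw [(hrun2 r₁ (by omega) le_rfl).2, hy1_p₂]
  have hy1_r₁ : ω (r₁ + 1) 1 = -1 := by rw [hys_r₁, hy_r₁]; rfl
  have hparc_r₁ : ω r₁ 0 % 2 = 0 := by rw [hy_r₁] at hpar_r₁; omega
  have hpos_r₁ := (hb' r₁ (by omega) (by omega)).1
  -- run 3 on row `−1`
  obtain ⟨e3, he3, hrun3⟩ := run_const_velocity hinj (a := r₁ + 1) (b := p₃) (by omega) (by omega)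
    (fun i hi1 hi2 => hhor' i (by omega) (by omega) (by omega) (by omega) (by omega) (by omega) (by omega) (by omega) (by omega))
  have hy_p₃ : ω p₃ 1 = -1 := by rw [(hrun3 p₃ (by omega) le_rfl).2, hy1_r₁]
  have hy1_p₃ : ω (p₃ + 1) 1 = -2 := by rw [hys_p₃, hy_p₃]; rfl
  have hparc_p₃ : ω p₃ 0 % 2 = 0 := by rw [hx_p₃, hy1_p₃] at hpar_p₃; omega
  have hpos_p₃ := (hb' p₃ (by omega) (by omega)).1
  -- run 4 on row `−2`
  obtain ⟨e4, he4, hrun4⟩ := run_const_velocity hinj (a := p₃ + 1) (b := r₂) (by omega) (by omega)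
    (fun i hi1 hi2 => hhor' i (by omega) (by omega) (by omega) (by omega) (by omega) (by omega) (by omega) (by omega) (by omega))
  have hy_r₂ : ω r₂ 1 = -2 := by rw [(hrun4 r₂ (by omega) le_rfl).2, hy1_p₃]
  have hy1_r₂ : ω (r₂ + 1) 1 = -1 := by rw [hys_r₂, hy_r₂]; rfl
  have hparc_r₂ : ω r₂ 0 % 2 = 0 := by rw [hy_r₂] at hpar_r₂; omega
  have hpos_r₂ := (hb' r₂ (by omega) (by omega)).1
  -- run 5 on row `−1`
  obtain ⟨e5, he5, hrun5⟩ := run_const_velocity hinj (a := r₂ + 1) (b := p₄) (by omega) (by omega)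
    (fun i hi1 hi2 => hhor' i (by omega) (by omega) (by omega) (by omega) (by omega) (by omega) (by omega) (by omega) (by omega))
  have hy_p₄ : ω p₄ 1 = -1 := by rw [(hrun5 p₄ (by omega) le_rfl).2, hy1_r₂]
  have hy1_p₄ : ω (p₄ + 1) 1 = -2 := by rw [hys_p₄, hy_p₄]; rfl
  have hparc_p₄ : ω p₄ 0 % 2 = 0 := by rw [hx_p₄, hy1_p₄] at hpar_p₄; omega
  have hpos_p₄ := (hb' p₄ (by omega) (by omega)).1
  -- run 6 on row `−2`
  obtain ⟨e6, he6, hrun6⟩ := run_const_velocity hinj (a := p₄ + 1) (b := r₃) (by omega) (by omega)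
    (fun i hi1 hi2 => hhor' i (by omega) (by omega) (by omega) (by omega) (by omega) (by omega) (by omega) (by omega) (by omega))
  have hy_r₃ : ω r₃ 1 = -2 := by rw [(hrun6 r₃ (by omega) le_rfl).2, hy1_p₄]
  have hy1_r₃ : ω (r₃ + 1) 1 = -1 := by rw [hys_r₃, hy_r₃]; rfl
  have hparc_r₃ : ω r₃ 0 % 2 = 0 := by rw [hy_r₃] at hpar_r₃; omega
  have hpos_r₃ := (hb' r₃ (by omega) (by omega)).1
  -- run 7 on row `−1`
  obtain ⟨e7, he7, hrun7⟩ := run_const_velocity hinj (a := r₃ + 1) (b := r₄) (by omega) (by omega)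
    (fun i hi1 hi2 => hhor' i (by omega) (by omega) (by omega) (by omega) (by omega) (by omega) (by omega) (by omega) (by omega))
  have hy_r₄ : ω r₄ 1 = -1 := by rw [(hrun7 r₄ (by omega) le_rfl).2, hy1_r₃]
  have hy1_r₄ : ω (r₄ + 1) 1 = 0 := by rw [hys_r₄, hy_r₄]; rfl
  have hparc_r₄ : ω r₄ 0 % 2 = 1 := by rw [hy_r₄] at hpar_r₄; omega
  have hsev : r₄ % 2 = 0 := by have := parity_apply hs (show r₄ ≤ m by omega); rw [hy_r₄] at this; omega
  -- the final run on the wall goes right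
  obtain ⟨e8, he8, hrun8⟩ := run_const_velocity hinj (a := r₄ + 1) (b := m) (by omega) le_rfl
    (fun i hi1 hi2 => hhor' i (by omega) (by omega) (by omega) (by omega) (by omega) (by omega) (by omega) (by omega)
      (by omega))
  obtain rfl : e8 = 1 := by
    rcases he8 with h | rfl
    · exact h
    exfalso
    have hN := (hrun8 m (by omega) le_rfl).1
    have hbn := (hb' (r₄ + 1) (by omega) (by omega)).2
    rw [hx_r₄] at hN hbn
    omega
  have hR8 : ∀ j, r₄ + 1 ≤ j → j ≤ m → ω j 0 = ω r₄ 0 + ((j - (r₄ + 1) : ℕ) : ℤ) ∧ ω j 1 = 0 := fun j hj1 hj2 => by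
    obtain ⟨hx, hy⟩ := hrun8 j hj1 hj2
    rw [hx_r₄] at hx; rw [hy1_r₄] at hy
    exact ⟨by rw [hx]; ring, hy⟩
  -- the visit count
  have hvf : visits m ω = p₁ / 2 + (m - r₄) / 2 := by
    have hv1 : visits p₁ ω = p₁ / 2 := visits_eq_div_two_of_wall (fun i _ hi2 => (hR0 i hi2).2)
    have hvA1 : visits r₄ ω = visits p₁ ω := by
      have := visits_add_eq_left (k := p₁) (b := r₄ - p₁) (ζ := ω) (fun j hj1 hj2 => ?_)
      · rwa [show p₁ + (r₄ - p₁) = r₄ by omega] at this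
      rintro ⟨-, hy⟩
      rcases Nat.lt_or_ge (p₁ + j) (p₂ + 1) with hj1' | hj1
      · have := (hrun1 (p₁ + j) (by omega) (by omega)).2; rw [hP1y] at this; omega
      rcases Nat.lt_or_ge (p₁ + j) (r₁ + 1) with hj2' | hj2
      · have := (hrun2 (p₁ + j) hj1 (by omega)).2; rw [hy1_p₂] at this; omega
      rcases Nat.lt_or_ge (p₁ + j) (p₃ + 1) with hj3' | hj3
      · have := (hrun3 (p₁ + j) hj2 (by omega)).2; rw [hy1_r₁] at this; omega
      rcases Nat.lt_or_ge (p₁ + j) (r₂ + 1) with hj4' | hj4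
      · have := (hrun4 (p₁ + j) hj3 (by omega)).2; rw [hy1_p₃] at this; omega
      rcases Nat.lt_or_ge (p₁ + j) (p₄ + 1) with hj5' | hj5
      · have := (hrun5 (p₁ + j) hj4 (by omega)).2; rw [hy1_r₂] at this; omega
      rcases Nat.lt_or_ge (p₁ + j) (r₃ + 1) with hj6' | hj6
      · have := (hrun6 (p₁ + j) hj5 (by omega)).2; rw [hy1_p₄] at this; omega
      · have := (hrun7 (p₁ + j) hj6 (by omega)).2; rw [hy1_r₃] at this; omega
    have hv3 : visits m ω = visits r₄ ω + visits (m - r₄) (fun _ => (0 : Site 2)) := by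
      have := visits_add (a := r₄) (b := m - r₄) (ζ := ω) (ξ := fun _ => (0 : Site 2)) hsev (fun j hj1 hj2 => ?_)
      · rwa [show r₄ + (m - r₄) = m by omega] at this
      rw [(hR8 (r₄ + j) (by omega) (by omega)).2]; rfl
    have hv4 : visits (m - r₄) (fun _ => (0 : Site 2)) = (m - r₄) / 2 := visits_eq_div_two_of_wall (fun i _ _ => rfl)
    rw [hv3, hvA1, hv1, hv4]
  rw [hvf] at hv
  have hpodd : p₁ % 2 = 1 := by rw [hP1x, hP1y] at hpar_p₁; omega
  have hs_eq : r₄ + 2 * k + 1 = m + p₁ :=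
    visits_count_td_w0 hm hv hpodd hsev hn_r₄
  have hN' : ω m 0 + p₁ = ω r₄ 0 + 2 * k := by
    rw [(hR8 m (by omega) le_rfl).1]; omega
  -- gaps between consecutive vertical steps
  have hgap1 : p₁ + 2 ≤ p₂ := by
    by_contra h
    obtain rfl : p₂ = p₁ + 1 := by omega
    rw [hx_p₂, hP1x] at hpar_p₂; rw [hy1_p₂] at hpar_p₂; omega
  have hgap2 : p₂ + 2 ≤ r₁ := by
    by_contra h
    obtain rfl : r₁ = p₂ + 1 := by omega
    have := hinj (hmem (p₂ + 1 + 1) (by omega)) (hmem p₂ (by omega))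
      (site_ext_td (by rw [hx_r₁, hx_p₂]) (by rw [hy1_r₁, hy_p₂]))
    omega
  have hgap3 : r₁ + 2 ≤ p₃ := by
    by_contra h
    obtain rfl : p₃ = r₁ + 1 := by omega
    have := hinj (hmem (r₁ + 1 + 1) (by omega)) (hmem r₁ (by omega))
      (site_ext_td (by rw [hx_p₃, hx_r₁]) (by rw [hy1_p₃, hy_r₁]))
    omega
  have hgap4 : p₃ + 2 ≤ r₂ := by
    by_contra h
    obtain rfl : r₂ = p₃ + 1 := by omega
    have := hinj (hmem (p₃ + 1 + 1) (by omega)) (hmem p₃ (by omega))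
      (site_ext_td (by rw [hx_r₂, hx_p₃]) (by rw [hy1_r₂, hy_p₃]))
    omega
  have hgap5 : r₂ + 2 ≤ p₄ := by
    by_contra h
    obtain rfl : p₄ = r₂ + 1 := by omega
    have := hinj (hmem (r₂ + 1 + 1) (by omega)) (hmem r₂ (by omega))
      (site_ext_td (by rw [hx_p₄, hx_r₂]) (by rw [hy1_p₄, hy_r₂]))
    omega
  have hgap6 : p₄ + 2 ≤ r₃ := by
    by_contra h
    obtain rfl : r₃ = p₄ + 1 := by omega
    have := hinj (hmem (p₄ + 1 + 1) (by omega)) (hmem p₄ (by omega))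
      (site_ext_td (by rw [hx_r₃, hx_p₄]) (by rw [hy1_r₃, hy_p₄]))
    omega
  refine ⟨e1, e2, e3, e4, e5, e6, e7, he1, he2, he3, he4, he5, he6, he7,
    fun i hi1 hi2 => ⟨by rw [(hrun1 i hi1 hi2).1, hP1x], by rw [(hrun1 i hi1 hi2).2, hP1y]⟩,
    fun i hi1 hi2 => ⟨by rw [(hrun2 i hi1 hi2).1, hx_p₂], by rw [(hrun2 i hi1 hi2).2, hy1_p₂]⟩,
    fun i hi1 hi2 => ⟨by rw [(hrun3 i hi1 hi2).1, hx_r₁], by rw [(hrun3 i hi1 hi2).2, hy1_r₁]⟩,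
    fun i hi1 hi2 => ⟨by rw [(hrun4 i hi1 hi2).1, hx_p₃], by rw [(hrun4 i hi1 hi2).2, hy1_p₃]⟩,
    fun i hi1 hi2 => ⟨by rw [(hrun5 i hi1 hi2).1, hx_r₂], by rw [(hrun5 i hi1 hi2).2, hy1_r₂]⟩,
    fun i hi1 hi2 => ⟨by rw [(hrun6 i hi1 hi2).1, hx_p₄], by rw [(hrun6 i hi1 hi2).2, hy1_p₄]⟩,
    fun i hi1 hi2 => ⟨by rw [(hrun7 i hi1 hi2).1, hx_r₃], by rw [(hrun7 i hi1 hi2).2, hy1_r₃]⟩,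
    hR8, hs_eq, hN', hparc_p₂, hparc_r₁, hparc_p₃, hparc_r₂, hparc_p₄, hparc_r₃, hparc_r₄, hpos_p₂, hpos_r₁, hpos_p₃,
    hpos_r₂, hpos_p₄, hpos_r₃, hgap1, hgap2, hgap3, hgap4, hgap5, hgap6, hn_r₄⟩


open Classical in
/-- Step 1 for `ddududuu_slack_four_false`: at most ONE interior visit time is a near-renewal (namely the time `2`).  The
interior visit times lie on the initial run or on the final run (the body stays on the rows `−1, −2`); a near-renewal on
the (rightward) final run would be a wall-renewal time (`isWRen_of_profile`), and an initial-run visit time `t ≥ 4` is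
followed by the return of the walk to the column `2` (`exists_left_step_onto`).  OURS (routine).
[cite: MadrasSlade1993, §4.2, Definition 4.2.1 (p. 90), remark before (4.2.21) (p. 94); EntingJensen2009, §7.4.2, Fig. 7.10] -/
theorem ddududuu_card_nearRenewal_le {k m : ℕ} (hm : m = 6 * k + 4) (hω : ω ∈ ipwb m) (hv : visits m ω = k)
    {p₁ p₂ p₃ p₄ r₁ r₂ r₃ r₄ : ℕ} (hD : stepsD m ω = {p₁, p₂, p₃, p₄}) (hU : stepsU m ω = {r₁, r₂, r₃, r₄}) (h12 : p₁ < p₂)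
    (h23 : p₂ < p₃) (h34 : p₃ < p₄) (hr12 : r₁ < r₂) (hr23 : r₂ < r₃) (hr34 : r₃ < r₄) (ht2 : p₂ < r₁) (ht3 : r₁ < p₃)
    (ht4 : p₃ < r₂) (ht5 : r₂ < p₄) (ht6 : p₄ < r₃) (hp1 : 1 ≤ p₁) (hR0 : ∀ i, i ≤ p₁ → ω i 0 = i ∧ ω i 1 = 0)
    (hP1x : ω (p₁ + 1) 0 = p₁) (hP1y : ω (p₁ + 1) 1 = -1)
    (hhor : ∀ i, i < m → i ∉ stepsD m ω → i ∉ stepsU m ω →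
      ω (i + 1) 1 = ω i 1 ∧ (ω (i + 1) 0 = ω i 0 + 1 ∨ ω (i + 1) 0 = ω i 0 - 1)) :
    #(((wallTimes m ω).erase m).filter fun t => NearRenewal m ω t) ≤ 1 := by
  classical
  obtain ⟨hpw, hn1, hirr⟩ := mem_ipwb.1 hω
  obtain ⟨hw, hb⟩ := mem_pwb.1 hpw
  obtain ⟨ha, -⟩ := mem_wbr.1 hw
  obtain ⟨hh, -, -⟩ := mem_archs.1 ha
  obtain ⟨hs, hhp⟩ := mem_hpw.1 hh
  obtain ⟨h0, -, hbw, hinj⟩ := mem_saws_iff.1 hs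
  have hX0 : ω 0 0 = 0 := by rw [h0]; rfl
  have hb' : ∀ i, 1 ≤ i → i ≤ m → 0 < ω i 0 ∧ ω i 0 ≤ ω m 0 := fun i h1 h2 => by
    have := hb i h1 h2; rwa [hX0] at this
  have hmem : ∀ i, i ≤ m → i ∈ {i | i ≤ m} := fun i hi => hi
  obtain ⟨e₁, e₂, e₃, e₄, e₅, e₆, e₇, -, -, -, -, -, -, -, hrun1, hrun2, hrun3, hrun4, hrun5, hrun6, hrun7, hR8, hs_eq, hN', -,
    -, -, -, -, -, -, -, -, -, -, -, -, -, -, -, -, -, -, hn_r₄⟩ :=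
    ddududuu4_runs hm hω hv hD hU h12 h23 h34 hr12 hr23 hr34 ht2 ht3 ht4 ht5 ht6 hp1 hR0 hP1x hP1y hhor
  refine le_trans (Finset.card_le_card fun t ht => ?_) (Finset.card_singleton 2).le
  rw [Finset.mem_filter, Finset.mem_erase, wallTimes, Finset.mem_filter, Finset.mem_Icc] at ht
  obtain ⟨⟨htm, ⟨ht1, htm'⟩, ht2, hy⟩, hR, hhead, htail⟩ := ht
  rw [Finset.mem_singleton]
  have htm'' : t < m := lt_of_le_of_ne htm' htm
  have hhead' : ∀ i, 1 ≤ i → i ≤ t → ω i 0 ≤ ω t 0 := fun i hi1 hi2 => by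
    rcases Nat.lt_or_ge i t with hit | hit
    · have := hhead i hit; omega
    · rw [show i = t by omega]
  rcases Nat.lt_or_ge t (p₁ + 1) with h0 | h0
  · -- an initial-run visit `t ≥ 4` is not a near-renewal: the walk comes back to the column `2`
    by_contra hne
    have ht4 : 4 ≤ t := by omega
    obtain ⟨i, him, hiL, hix⟩ := exists_left_step_onto hω (show 1 ≤ 2 by norm_num) (show 2 < m by omega) (by norm_num)
      (hR0 2 (by omega)).2 (by rw [(hR0 3 (by omega)).1, (hR0 2 (by omega)).1]; norm_num)
    have hip : p₁ ≤ i := by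
      by_contra hlt
      have h1 := (hR0 (i + 1) (by omega)).1
      have h2 := (hR0 i (by omega)).1
      rw [h1, h2] at hiL
      push_cast at hiL
      omega
    have := htail (i + 1) (by omega) (by omega)
    rw [(hR0 t (by omega)).1, hix, (hR0 2 (by omega)).1] at this
    push_cast at this
    omega
  exfalso
  rcases Nat.lt_or_ge t (p₂ + 1) with h1 | h1
  · have := (hrun1 t h0 (by omega)).2; omega
  rcases Nat.lt_or_ge t (r₁ + 1) with h2 | h2
  · have := (hrun2 t h1 (by omega)).2; omega
  rcases Nat.lt_or_ge t (p₃ + 1) with h3 | h3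
  · have := (hrun3 t h2 (by omega)).2; omega
  rcases Nat.lt_or_ge t (r₂ + 1) with h4 | h4
  · have := (hrun4 t h3 (by omega)).2; omega
  rcases Nat.lt_or_ge t (p₄ + 1) with h5 | h5
  · have := (hrun5 t h4 (by omega)).2; omega
  rcases Nat.lt_or_ge t (r₃ + 1) with h6 | h6
  · have := (hrun6 t h5 (by omega)).2; omega
  rcases Nat.lt_or_ge t (r₄ + 1) with h7 | h7
  · have := (hrun7 t h6 (by omega)).2; omega
  · -- on the final wall run: a wall-renewal time
    refine hirr t ht1 htm'' (isWRen_of_profile hb htm' ht2 hy hhead' fun j hj1 hj2 => ?_)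
    have := (hR8 t h7 htm').1; have := (hR8 j (by omega) hj2).1; omega

open Classical in
/-- **The order `D D U D U D U U` does not occur at slack four.** For an irreducible positive wall bridge of length `6k + 4`
(`k ≥ 2`) with `k` visits and four down steps, in the vertical profile of `profile_of_card_stepsD_eq_four`, the order
`p₁ < p₂ < r₁ < p₃ < r₂ < p₄ < r₃ < r₄` of its down times `pᵢ` and up times `rᵢ` is impossible: by
`ddududuu_card_nearRenewal_le` and `slack_four_counts` the span is `2k + 2` and the time `2` is a near-renewal, so the
`4k + 3` body sites (times `p₁ < t ≤ r₄`; the visit count of `ddududuu4_runs`) are distinct sites of the box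
`[2, 2k + 2] × {−2, −1}`, which has `4k + 2` sites.  NEW, a-idea-1 lineage.
[cite: MadrasSlade1993, §4.2, Definition 4.2.1 (p. 90), remark before (4.2.21) (p. 94); EntingJensen2009, §7.4.2, Fig. 7.10] -/
theorem ddududuu_slack_four_false {k m : ℕ} (hk : 2 ≤ k) (hm : m = 6 * k + 4) (hω : ω ∈ ipwb m) (hv : visits m ω = k)
    (hcD : #(stepsD m ω) = 4) {p₁ p₂ p₃ p₄ r₁ r₂ r₃ r₄ : ℕ} (hD : stepsD m ω = {p₁, p₂, p₃, p₄})
    (hU : stepsU m ω = {r₁, r₂, r₃, r₄}) (h12 : p₁ < p₂)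
    (h23 : p₂ < p₃) (h34 : p₃ < p₄) (hr12 : r₁ < r₂) (hr23 : r₂ < r₃) (hr34 : r₃ < r₄) (ht2 : p₂ < r₁) (ht3 : r₁ < p₃)
    (ht4 : p₃ < r₂) (ht5 : r₂ < p₄) (ht6 : p₄ < r₃) (hp1 : 1 ≤ p₁) (hR0 : ∀ i, i ≤ p₁ → ω i 0 = i ∧ ω i 1 = 0)
    (hP1x : ω (p₁ + 1) 0 = p₁) (hP1y : ω (p₁ + 1) 1 = -1)
    (hhor : ∀ i, i < m → i ∉ stepsD m ω → i ∉ stepsU m ω →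
      ω (i + 1) 1 = ω i 1 ∧ (ω (i + 1) 0 = ω i 0 + 1 ∨ ω (i + 1) 0 = ω i 0 - 1)) : False := by
  classical
  obtain ⟨hpw, hn1, hirr⟩ := mem_ipwb.1 hω
  obtain ⟨hw, hb⟩ := mem_pwb.1 hpw
  obtain ⟨ha, -⟩ := mem_wbr.1 hw
  obtain ⟨hh, -, -⟩ := mem_archs.1 ha
  obtain ⟨hs, hhp⟩ := mem_hpw.1 hh
  obtain ⟨h0, -, hbw, hinj⟩ := mem_saws_iff.1 hs
  have hX0 : ω 0 0 = 0 := by rw [h0]; rfl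
  have hb' : ∀ i, 1 ≤ i → i ≤ m → 0 < ω i 0 ∧ ω i 0 ≤ ω m 0 := fun i h1 h2 => by
    have := hb i h1 h2; rwa [hX0] at this
  have hmem : ∀ i, i ≤ m → i ∈ {i | i ≤ m} := fun i hi => hi
  obtain ⟨e₁, e₂, e₃, e₄, e₅, e₆, e₇, -, -, -, -, -, -, -, hrun1, hrun2, hrun3, hrun4, hrun5, hrun6, hrun7, hR8, hs_eq, hN', -,
    -, -, -, -, -, -, -, -, -, -, -, -, -, -, -, -, -, -, hn_r₄⟩ :=
    ddududuu4_runs hm hω hv hD hU h12 h23 h34 hr12 hr23 hr34 ht2 ht3 ht4 ht5 ht6 hp1 hR0 hP1x hP1y hhor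
  have hE1 := ddududuu_card_nearRenewal_le hm hω hv hD hU h12 h23 h34 hr12 hr23 hr34 ht2 ht3 ht4 ht5 ht6 hp1 hR0 hP1x hP1y hhor
  -- the span is `2k + 2`, and the time `2` is a near-renewal: every later column is `≥ 2`
  obtain ⟨hX3, -, -, -, -, -, h6x, h2x, h4x⟩ := slack_four_counts hk hm hω hv
  have hX : ω m 0 = 2 * k + 2 := by
    rcases hX3 with h | h | h
    · exact h
    · have := ((h4x h).1 hcD).1; omega
    · have := (h6x h).1; omega
  obtain ⟨h40, -, h41⟩ := h2x hX
  have hE := h41 hcD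
  obtain ⟨t, ht, htlt⟩ :
      ∃ t ∈ ((wallTimes m ω).erase m).filter (fun t => NearRenewal m ω t), t < 4 := by
    by_contra hne
    have hsub : (((wallTimes m ω).erase m).filter fun t => NearRenewal m ω t) ⊆
        ((wallTimes m ω).erase m).filter fun t => 4 ≤ t ∧ NearRenewal m ω t := fun t ht => by
      have h4t : 4 ≤ t := not_lt.1 fun h => hne ⟨t, ht, h⟩
      rw [Finset.mem_filter] at ht ⊢
      exact ⟨ht.1, h4t, ht.2⟩
    have := Finset.card_le_card hsub
    omega
  rw [Finset.mem_filter, Finset.mem_erase, wallTimes, Finset.mem_filter, Finset.mem_Icc] at ht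
  obtain ⟨⟨-, ⟨htge, -⟩, htev, hy⟩, -, -, htail⟩ := ht
  obtain rfl : t = 2 := by omega
  have hp2 : 2 ≤ p₁ := by
    by_contra hlt
    have : p₁ = 1 := by omega
    subst this
    rw [hP1y] at hy
    exact absurd hy (by norm_num)
  have h22 : ω 2 0 = 2 := by rw [(hR0 2 hp2).1]; rfl
  -- pigeonhole: the `4k + 3` body sites are distinct sites of the box `[2, 2k + 2] × {−2, −1}`
  have hrow : ∀ i, p₁ + 1 ≤ i → i ≤ r₄ → ω i 1 = -1 ∨ ω i 1 = -2 := fun i hi1 hi2 => by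
    rcases Nat.lt_or_ge i (p₂ + 1) with h1 | h1
    · exact Or.inl (hrun1 i hi1 (by omega)).2
    rcases Nat.lt_or_ge i (r₁ + 1) with h2 | h2
    · exact Or.inr (hrun2 i h1 (by omega)).2
    rcases Nat.lt_or_ge i (p₃ + 1) with h3 | h3
    · exact Or.inl (hrun3 i h2 (by omega)).2
    rcases Nat.lt_or_ge i (r₂ + 1) with h4 | h4
    · exact Or.inr (hrun4 i h3 (by omega)).2
    rcases Nat.lt_or_ge i (p₄ + 1) with h5 | h5
    · exact Or.inl (hrun5 i h4 (by omega)).2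
    rcases Nat.lt_or_ge i (r₃ + 1) with h6 | h6
    · exact Or.inr (hrun6 i h5 (by omega)).2
    · exact Or.inl (hrun7 i h6 hi2).2
  have hcard := Finset.card_le_card_of_injOn (s := Finset.Icc (p₁ + 1) r₄)
    (t := Finset.Icc (2 : ℤ) (2 * k + 2) ×ˢ Finset.Icc (-2 : ℤ) (-1)) (fun i => (ω i 0, ω i 1))
    (fun i hi => by
      have hi' := Finset.mem_Icc.1 (Finset.mem_coe.1 hi)
      have hlo := htail i (by omega) (by omega)
      have hhi := (hb' i (by omega) (by omega)).2
      rw [h22] at hlo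
      rw [hX] at hhi
      show (ω i 0, ω i 1) ∈ Finset.Icc (2 : ℤ) (2 * k + 2) ×ˢ Finset.Icc (-2 : ℤ) (-1)
      rw [Finset.mem_product, Finset.mem_Icc, Finset.mem_Icc]
      rcases hrow i hi'.1 hi'.2 with h | h <;> rw [h] <;> exact ⟨⟨hlo, hhi⟩, by norm_num, by norm_num⟩)
    (fun i hi j hj hij => by
      have hi' := Finset.mem_Icc.1 (Finset.mem_coe.1 hi)
      have hj' := Finset.mem_Icc.1 (Finset.mem_coe.1 hj)
      obtain ⟨h0', h1'⟩ := Prod.mk.inj hij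
      exact hinj (hmem i (by omega)) (hmem j (by omega)) (site_ext_td h0' h1'))
  rw [Nat.card_Icc, Finset.card_product, Int.card_Icc, Int.card_Icc] at hcard
  have h1 : ((2 : ℤ) * k + 2 + 1 - 2).toNat = 2 * k + 1 := by omega
  have h2 : ((-1 : ℤ) + 1 - (-2)).toNat = 2 := by decide
  rw [h1, h2] at hcard
  omega

end Literature.Probability.RandomPlanarGeometry.SAW.HexBW.Wall
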